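import Mathlib.Algebra.Ring.BooleanRing
import Literature.Computability.QuantumComplexity.ForrelationDerivativeTables
import Literature.Computability.QuantumComplexity.ForrelationDirectSum
import Literature.Computability.AlgebraicComplexity.PowerSumNonvanishing
import Literature.NumberTheory.LFunctions.WooleyPolyToolkit

/-!
# `NearExactIsExact` (stmt-QuantumAdvantage-14043), line `direct-sum-amplification` — stub F2:
# the Maiorana–McFarland ceiling `Φ ∈ {1} ∪ [−1, 31/32]`

Stub `stub_mmFormCeiling` of the crux `Summit.QuantumAdvantage.QuantumAdvantage.Theses.CubicForrelation.NearExactIsExact`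
(self-contained; the same tools are also landed separately as `CubicForrelationNearExactIsExactMmFormCeilingA.lean`).
For `f` cubic on `m + m` bits, `π` coordinatewise quadratic, `h` cubic and `g` in Maiorana–McFarland SIGN FORM
`(-1)^{g(y₁ ‖ y₂)} = (-1)^{y₁·π(y₂)} (-1)^{h(y₂)}`: `Φ(f,g) = 1 ∨ Φ(f,g) ≤ 31/32`, GIVEN as hypotheses the neighbouring
stubs D (a derivative lowers the degree), R (Reed–Muller minimum weight, division free), F1 (MM Walsh identity).

Proof (derivative form of Disproof §3 of the crux, no ANF coefficients). By F1, `2^{2m} Φ = Σ_{y₂} (-1)^{h y₂} S(y₂)`,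
`S(y₂) = Σ_{x₂} (-1)^{q_{y₂} x₂}` with the cubic FIBRE function `q_{y₂} = f(π y₂ ‖ ·) ⊕ ℓ_{y₂}` (`ℓ_y` the linear form
with `(-1)^{ℓ_y x} = (-1)^{x·y}`, `mf_linForm_exists`). Its first / second coordinate derivatives are
`(D₁ᵢ f)(π y₂ ‖ ·) ⊕ (y₂)ᵢ` and `(D₂ᵢⱼ f)(π y₂ ‖ ·)`, `D₁ᵢ f = f ⊕ f(· ⊕ (0 ‖ eᵢ))` of degree `≤ 2` and
`D₂ᵢⱼ f = D₁ᵢ f ⊕ (D₁ᵢ f)(· ⊕ (0 ‖ eⱼ))` of degree `≤ 1` (by D). FIBRE TRICHOTOMY: some second derivative `≠ 0` ⇒ `q`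
takes both values ⇒ `|S| ≤ (3/4)2^m` (R, `d = 3`, on `q` and `¬q`: `mf_bias`); all second derivatives `0` but a first
one `≠ 0` ⇒ that first derivative is constant `1` (`mf_const_of_shift`) ⇒ `q(x ⊕ eᵢ) = ¬q(x)` ⇒ `S = 0` (involution);
all first derivatives `0` ⇒ `q` constant ⇒ `S = 2^m (-1)^{f(π y₂ ‖ 0)}`. DENSITIES: a witness
`(D₂ᵢⱼ f)(π y₀ ‖ x₀) = 1` makes `y₂ ↦ (D₂ᵢⱼ f)(π y₂ ‖ x₀)` a nonzero function of degree `≤ 2` (degree under substitution,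
`mf_isDegLeFun_comp`, `Wooley.totalDegree_bind₁_le_mul`), so `≥ 2^m/4` fibres are non-affine (R) and `Φ ≤ 15/16`
(`mf_avg_core`); else a witness `(D₁ᵢ f)(π y₀ ‖ x₀) ⊕ (y₀)ᵢ = 1` gives a nonzero function of degree `≤ 4`, `≥ 2^m/16`
balanced fibres and again `Φ ≤ 15/16`; else `Φ = 2^{-m} Σ (-1)^{h ⊕ f(π(·) ‖ 0)}`, the bias of a word of degree `≤ 6`,
which is `1` or `≤ 1 − 2/64 = 31/32` (R, `d = 6`). Orientation: C. Carlet, Boolean Functions for Cryptography and Coding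
Theory (CUP 2020), §2.2 and Prop. 54; the bound `15/16` of the first two cases is attained (`Negative/FifteenSixteenths`).
-/

noncomputable section

set_option linter.dupNamespace false -- D-0017: single-problem summit ⇒ `QuantumAdvantage.QuantumAdvantage` by design

namespace Summit.QuantumAdvantage.QuantumAdvantage.Theorems.CubicForrelation.NearExactIsExact

open Finset
open Literature.Computability.QuantumComplexity
open Literature.Computability.QuantumComplexity.BuzetChailloux (bxor zeroVec signOf_sq bxor_zeroVec bxorPerm
  bxorPerm_apply bxor_comm twist_zeroVec_right)

variable {m n : ℕ}

/-! ### Boolean bookkeeping, flips, counting -/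

/-- `a ⊕ b = 0 ⇒ b = a`. -/
private theorem mf_xor_false : ∀ a b : Bool, (a ^^ b) = false → b = a := by decide

/-- `a ⊕ b = 1 ⇒ b = ¬a`. -/
private theorem mf_xor_true : ∀ a b : Bool, (a ^^ b) = true → b = !a := by decide

/-- An odd number of four bits are set ⇒ some bit is set and some bit is clear. -/
private theorem mf_odd4 : ∀ a b c d : Bool, ((a ^^ b) ^^ (c ^^ d)) = true →
    (a = true ∨ b = true ∨ c = true ∨ d = true) ∧ (a = false ∨ b = false ∨ c = false ∨ d = false) := by decide

/-- `(a ⊕ c) ⊕ (b ⊕ (c ⊕ d)) = (a ⊕ b) ⊕ d`. -/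
private theorem mf_id1 : ∀ a b c d : Bool, ((a ^^ c) ^^ (b ^^ (c ^^ d))) = ((a ^^ b) ^^ d) := by decide

/-- `(a ⊕ c) ⊕ (b ⊕ c) = a ⊕ b`. -/
private theorem mf_id2 : ∀ a b c : Bool, ((a ^^ c) ^^ (b ^^ c)) = (a ^^ b) := by decide

/-- Degree `≤ d` is closed under xor (sum of representing polynomials). -/
private theorem mf_deg_bxor {d : ℕ} {f g : (Fin m → Bool) → Bool} (hf : IsDegLeFun d f) (hg : IsDegLeFun d g) :
    IsDegLeFun d (fun x => f x ^^ g x) := by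
  have add2 : ∀ a b : ZMod 2, decide (a + b = 1) = (decide (a = 1) ^^ decide (b = 1)) := by decide
  obtain ⟨p, hp, hpf⟩ := hf
  obtain ⟨q, hq, hqg⟩ := hg
  refine ⟨p + q, (MvPolynomial.totalDegree_add p q).trans (max_le hp hq), fun x => ?_⟩
  show (f x ^^ g x) = polyPhase (p + q) x
  rw [hpf, hqg, polyPhase_apply, polyPhase_apply, polyPhase_apply, map_add]
  exact (add2 _ _).symm

/-- The basis vector `eᵢ = Pi.single i true` has coordinates `[k = i]`. -/
private theorem mf_single_apply (i k : Fin m) : (Pi.single i true : Fin m → Bool) k = decide (k = i) := by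
  by_cases h : k = i
  · subst h; simp
  · rw [Pi.single_eq_of_ne h, decide_eq_false h]; rfl

/-- A Boolean function invariant under every coordinate flip `x ↦ x ⊕ eᵢ` is constant. -/
private theorem mf_const_of_shift (Q : (Fin m → Bool) → Bool)
    (h : ∀ (i : Fin m) (x : Fin m → Bool), Q (bxor x (Pi.single i true)) = Q x) (x : Fin m → Bool) :
    Q x = Q zeroVec := by
  classical
  suffices H : ∀ (s : Finset (Fin m)) (x : Fin m → Bool), (∀ i, x i = true → i ∈ s) → Q x = Q zeroVec from
    H univ x fun i _ => mem_univ i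
  intro s
  induction s using Finset.induction_on with
  | empty =>
    intro x hx
    rw [show x = zeroVec from funext fun i => Bool.eq_false_iff.2 fun hi => Finset.notMem_empty i (hx i hi)]
  | @insert i s _ ih =>
    intro x hx
    by_cases hxi : x i = true
    · rw [← h i x]
      refine ih _ fun j hj => ?_
      have hj' : (x j ^^ (Pi.single i true : Fin m → Bool) j) = true := hj
      rw [mf_single_apply] at hj'
      by_cases hji : j = i
      · subst hji; simp [hxi] at hj'
      · rw [decide_eq_false hji, Bool.xor_false] at hj'
        exact (mem_insert.1 (hx j hj')).resolve_left hji
    · exact ih x fun j hj => (mem_insert.1 (hx j hj)).resolve_left fun e => hxi (e ▸ hj)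

/-- If the flip `x ↦ x ⊕ t` negates `Q`, then `Q` is balanced. -/
private theorem mf_sum_signOf_eq_zero_of_flip (Q : (Fin m → Bool) → Bool) (t : Fin m → Bool)
    (h : ∀ x, Q (bxor x t) = !Q x) : ∑ x, signOf (Q x) = 0 := by
  have e1 : ∑ x, signOf (Q (bxor x t)) = ∑ x, signOf (Q x) :=
    Fintype.sum_equiv (bxorPerm t) _ _ fun x => by rw [bxorPerm_apply, bxor_comm]
  have e2 : ∑ x, signOf (Q (bxor x t)) = -∑ x, signOf (Q x) := by
    rw [← sum_neg_distrib]
    exact sum_congr rfl fun x _ => by rw [h, DerivativeWalsh.signOf_not]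
  linarith

/-- `Σ_x (-1)^{Q x} = 2^m − 2·#{Q = 1}`. -/
private theorem mf_sum_signOf_eq_card (Q : (Fin m → Bool) → Bool) :
    ∑ x, signOf (Q x) = (2 : ℝ) ^ m - 2 * ((univ.filter fun x => Q x = true).card : ℝ) := by
  have e : ∀ x, signOf (Q x) = 1 - 2 * (if Q x = true then (1 : ℝ) else 0) := fun x => by
    cases Q x <;> norm_num [signOf]
  simp_rw [e]
  rw [sum_sub_distrib, ← mul_sum, sum_boole, sum_const, card_univ, Fintype.card_fun, Fintype.card_bool,
    Fintype.card_fin, nsmul_eq_mul, mul_one]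
  push_cast; ring

/-- `|Σ_x (-1)^{Q x}| ≤ 2^m`. -/
private theorem mf_abs_sum_signOf_le (Q : (Fin m → Bool) → Bool) : |∑ x, signOf (Q x)| ≤ (2 : ℝ) ^ m := by
  refine (abs_sum_le_sum_abs _ _).trans (le_of_eq ?_)
  simp only [abs_signOf, sum_const, card_univ, Fintype.card_fun, Fintype.card_bool, Fintype.card_fin, nsmul_eq_mul]
  push_cast; ring

/-- **Bias of a non-constant cubic** (Reed–Muller minimum weight `hR` = stub R with `d = 3` on `Q` and `¬Q`). -/
private theorem mf_bias
    (hR : ∀ (m d : ℕ) (e : (Fin m → Bool) → Bool), IsDegLeFun d e → (∃ x, e x = true) →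
      2 ^ m ≤ 2 ^ d * (univ.filter fun x => e x = true).card)
    {Q : (Fin m → Bool) → Bool} (hQ : IsDegLeFun 3 Q) (h1 : ∃ x, Q x = true) (h0 : ∃ x, Q x = false) :
    |∑ x, signOf (Q x)| ≤ 3 / 4 * (2 : ℝ) ^ m := by
  obtain ⟨x0, hx0⟩ := h0
  have hT := (Nat.cast_le (α := ℝ)).2 (hR m 3 Q hQ h1)
  have hF := (Nat.cast_le (α := ℝ)).2
    (hR m 3 (fun x => Q x ^^ true) (mf_deg_bxor hQ (isDegLeFun_const 3 true)) ⟨x0, by simp [hx0]⟩)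
  push_cast at hT hF
  have hcard : ((univ.filter fun x => Q x = true).card : ℝ) +
      ((univ.filter fun x => (Q x ^^ true) = true).card : ℝ) = (2 : ℝ) ^ m := by
    have e := card_filter_add_card_filter_not (s := (univ : Finset (Fin m → Bool))) (fun x => Q x = true)
    rw [card_univ, Fintype.card_fun, Fintype.card_bool, Fintype.card_fin] at e
    rw [show (univ.filter fun x => (Q x ^^ true) = true) = univ.filter fun x => ¬(Q x = true) from
      filter_congr fun x _ => by simp]
    exact_mod_cast e
  rw [mf_sum_signOf_eq_card, abs_le]
  constructor <;> nlinarith [hT, hF, hcard]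

/-! ### Degree under substitution -/

/-- Values of `𝔽₂`-polynomials at `0/1`-points are `[polyPhase]`. -/
private theorem mf_eval_eq_ite (q : MvPolynomial (Fin m) (ZMod 2)) (x : Fin m → Bool) :
    MvPolynomial.eval (fun j => if x j then (1 : ZMod 2) else 0) q = if polyPhase q x then 1 else 0 := by
  have dich : ∀ a : ZMod 2, a = 0 ∨ a = 1 := by decide
  rw [polyPhase_apply]
  rcases dich (MvPolynomial.eval (fun j => if x j then (1 : ZMod 2) else 0) q) with h | h <;> rw [h] <;> decide

/-- **Degree under substitution**: `F ∘ σ` has degree `≤ K` whenever `F` has degree `≤ k`, every coordinate of `σ`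
has degree `≤ D` and `D·k ≤ K` (`bind₁` of representing polynomials, `Wooley.totalDegree_bind₁_le_mul`). -/
private theorem mf_isDegLeFun_comp {k D K : ℕ} {F : (Fin n → Bool) → Bool} (hF : IsDegLeFun k F)
    (σ : (Fin m → Bool) → (Fin n → Bool)) (hσ : ∀ v, IsDegLeFun D (fun x => σ x v)) (hK : D * k ≤ K) :
    IsDegLeFun K (fun x => F (σ x)) := by
  classical
  obtain ⟨p, hp, hpF⟩ := hF
  choose q hq hqσ using hσ
  refine ⟨MvPolynomial.bind₁ q p, (Literature.NumberTheory.LFunctions.Wooley.totalDegree_bind₁_le_mul q p hq).trans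
    ((Nat.mul_le_mul_left D hp).trans hK), fun x => ?_⟩
  have hpt : (fun j => if σ x j then (1 : ZMod 2) else 0) =
      fun v => MvPolynomial.eval (fun j => if x j then (1 : ZMod 2) else 0) (q v) := by
    funext v
    rw [mf_eval_eq_ite, ← hqσ v x]
  show F (σ x) = _
  rw [hpF, polyPhase_apply, polyPhase_apply,
    show MvPolynomial.eval (fun j => if x j then (1 : ZMod 2) else 0) (MvPolynomial.bind₁ q p) =
      MvPolynomial.eval (fun v => MvPolynomial.eval (fun j => if x j then (1 : ZMod 2) else 0) (q v)) p from
      MvPolynomial.eval₂Hom_bind₁ _ _ _ _, hpt]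

/-- `(a ‖ b) ⊕ (c ‖ d) = (a ⊕ c) ‖ (b ⊕ d)`. -/
private theorem mf_bxor_append (a c : Fin m → Bool) (b d : Fin n → Bool) :
    bxor (Fin.append a b) (Fin.append c d) = Fin.append (bxor a c) (bxor b d) := by
  funext v
  induction v using Fin.addCases with
  | left i => simp only [bxor, Fin.append_left]
  | right j => simp only [bxor, Fin.append_right]

/-- The coordinates of `x ↦ (c ‖ x)` have degree `≤ 1`. -/
private theorem mf_deg_coord_append_left (c : Fin m → Bool) (v : Fin (m + n)) :
    IsDegLeFun 1 (fun x : Fin n → Bool => Fin.append c x v) := by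
  induction v using Fin.addCases with
  | left i => simp only [Fin.append_left]; exact isDegLeFun_const 1 (c i)
  | right j => simp only [Fin.append_right]; exact isDegLeFun_apply j le_rfl

/-- The coordinates of `y ↦ (π y ‖ c)` have degree `≤ 2` when `π` is coordinatewise quadratic. -/
private theorem mf_deg_coord_append_pi {π : (Fin m → Bool) → (Fin m → Bool)}
    (hπ : ∀ i, IsDegLeFun 2 (fun y => π y i)) (c : Fin n → Bool) (v : Fin (m + n)) :
    IsDegLeFun 2 (fun y : Fin m → Bool => Fin.append (π y) c v) := by
  induction v using Fin.addCases with
  | left i => simp only [Fin.append_left]; exact hπ i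
  | right j => simp only [Fin.append_right]; exact isDegLeFun_const 2 (c j)

/-! ### Boolean linear forms -/

/-- **Linear forms.** For every `y` there is `ℓ_y` of degree `≤ 1` with `(-1)^{ℓ_y(x)} = (-1)^{x·y}`
(namely `ℓ_y = Σ_{i : yᵢ = 1} Xᵢ`). -/
private theorem mf_linForm_exists (m : ℕ) : ∃ l : (Fin m → Bool) → (Fin m → Bool) → Bool,
    (∀ y, IsDegLeFun 1 (l y)) ∧ ∀ y x, signOf (l y x) = twist x y := by
  refine ⟨fun y x => polyPhase (∑ i : Fin m, MvPolynomial.C (if y i then (1 : ZMod 2) else 0) * MvPolynomial.X i) x,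
    fun y => isDegLeFun_polyPhase (Literature.Computability.AlgebraicComplexity.totalDegree_sum_C_mul_X_le _),
    fun y x => ?_⟩
  have hev : MvPolynomial.eval (fun j => if x j then (1 : ZMod 2) else 0)
      (∑ i : Fin m, MvPolynomial.C (if y i then (1 : ZMod 2) else 0) * MvPolynomial.X i) =
      ((univ.filter fun i => x i && y i).card : ZMod 2) := by
    rw [map_sum, ← sum_boole]
    refine sum_congr rfl fun i _ => ?_
    rw [map_mul, MvPolynomial.eval_C, MvPolynomial.eval_X]
    cases x i <;> cases y i <;> simp
  beta_reduce
  rw [polyPhase_apply, hev, Simon.twist_eq_neg_one_pow]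
  rcases Nat.even_or_odd (univ.filter fun i => x i && y i).card with he | ho
  · rw [he.neg_one_pow, ZMod.natCast_eq_zero_iff_even.2 he, show decide ((0 : ZMod 2) = 1) = false from by decide]
    rfl
  · rw [ho.neg_one_pow, ZMod.natCast_eq_one_iff_odd.2 ho, show decide ((1 : ZMod 2) = 1) = true from by decide]
    rfl

/-- Such an `ℓ_y` is additive, reads `yᵢ` on the basis vector `eᵢ` and vanishes at `0` (`signOf` is injective). -/
private theorem mf_lin_props {l : (Fin m → Bool) → Bool} {y : Fin m → Bool} (hl : ∀ x, signOf (l x) = twist x y) :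
    (∀ x t, l (bxor x t) = (l x ^^ l t)) ∧ (∀ i, l (Pi.single i true) = y i) ∧ l zeroVec = false := by
  have inj : ∀ a b : Bool, signOf a = signOf b → a = b := fun a b h => by
    cases a <;> cases b <;> first | rfl | (exfalso; norm_num [signOf] at h)
  refine ⟨fun x t => inj _ _ ?_, fun i => inj _ _ ?_, inj _ _ ?_⟩
  · rw [signOf_xor, hl, hl, hl]
    exact Simon.twist_xor_left x t y
  · rw [hl, twist, Finset.prod_eq_single i (fun k _ hk => by
      rw [mf_single_apply, decide_eq_false hk, Bool.false_and, if_neg Bool.false_ne_true])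
      (fun h => absurd (mem_univ i) h)]
    simp [signOf]
  · rw [hl, twist_comm, twist_zeroVec_right]
    rfl

/-- **Averaging core**: if `|S| ≤ 2^m` everywhere, `|S| ≤ b` on `s`, and the deficit `#s · (2^m − b)` is at least
`4^m/16`, then `Σ_y |S y| ≤ (15/16)·4^m`. -/
private theorem mf_avg_core (S : (Fin m → Bool) → ℝ) (hS : ∀ y, |S y| ≤ (2 : ℝ) ^ m) (s : Finset (Fin m → Bool))
    (b : ℝ) (hb : ∀ y ∈ s, |S y| ≤ b) (hdef : (2 : ℝ) ^ m * 2 ^ m ≤ 16 * ((s.card : ℝ) * (2 ^ m - b))) :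
    ∑ y, |S y| ≤ 15 / 16 * ((2 : ℝ) ^ m * 2 ^ m) := by
  classical
  rw [← sum_add_sum_compl s fun y => |S y|]
  have hin : ∑ y ∈ s, |S y| ≤ s.card * b := by
    rw [← nsmul_eq_mul]; exact sum_le_card_nsmul _ _ _ hb
  have hout : ∑ y ∈ sᶜ, |S y| ≤ (sᶜ).card * (2 : ℝ) ^ m := by
    rw [← nsmul_eq_mul]; exact sum_le_card_nsmul _ _ _ fun y _ => hS y
  have hcard : ((s.card : ℝ) + ((sᶜ).card : ℝ)) * 2 ^ m = 2 ^ m * 2 ^ m := by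
    rw [← Nat.cast_add, s.card_add_card_compl, Fintype.card_fun, Fintype.card_bool, Fintype.card_fin]
    push_cast
    rfl
  linarith [add_mul (s.card : ℝ) ((sᶜ).card : ℝ) ((2 : ℝ) ^ m)]

/-! ### The ceiling -/

/-- **stub_mmFormCeiling** (F2): for `f` cubic on `m + m` bits, `π` coordinatewise quadratic, `h` cubic and `g` in
Maiorana–McFarland sign form, `Φ(f,g) = 1 ∨ Φ(f,g) ≤ 31/32`, from the statements of the stubs D (derivative degree
drop), R (Reed–Muller minimum weight) and F1 (MM Walsh identity) — see the module docstring for the proof. -/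
theorem stub_mmFormCeiling :
    (∀ (n d : ℕ) (e : (Fin n → Bool) → Bool) (t : Fin n → Bool), IsDegLeFun (d + 1) e →
      IsDegLeFun d (fun x => e x ^^ e (bxor x t))) →
    (∀ (m d : ℕ) (e : (Fin m → Bool) → Bool), IsDegLeFun d e → (∃ x, e x = true) →
      2 ^ m ≤ 2 ^ d * (univ.filter fun x => e x = true).card) →
    (∀ (m : ℕ) (f g : (Fin (m + m) → Bool) → Bool) (π : (Fin m → Bool) → (Fin m → Bool)) (h : (Fin m → Bool) → Bool),
      (∀ y₁ y₂ : Fin m → Bool, signOf (g (Fin.append y₁ y₂)) = twist y₁ (π y₂) * signOf (h y₂)) →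
      forrelation f g = ((2 : ℝ) ^ (2 * m))⁻¹ *
        ∑ y₂ : Fin m → Bool, signOf (h y₂) * ∑ x₂ : Fin m → Bool, signOf (f (Fin.append (π y₂) x₂)) * twist x₂ y₂) →
    ∀ (m : ℕ) (f g : (Fin (m + m) → Bool) → Bool) (π : (Fin m → Bool) → (Fin m → Bool)) (h : (Fin m → Bool) → Bool),
      IsDegLeFun 3 f → (∀ i : Fin m, IsDegLeFun 2 (fun y => π y i)) → IsDegLeFun 3 h →
      (∀ y₁ y₂ : Fin m → Bool, signOf (g (Fin.append y₁ y₂)) = twist y₁ (π y₂) * signOf (h y₂)) →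
      forrelation f g = 1 ∨ forrelation f g ≤ 31 / 32 := by
  intro hD hR hW m f g π h hf hπ hh hg
  classical
  obtain ⟨l, hl1, hl⟩ := mf_linForm_exists m
  -- coordinate directions of the second block, the two derivatives of `f`, the fibre functions `q y = f(π y ‖ ·) ⊕ ℓ_y`
  obtain ⟨T, hT⟩ : ∃ T : Fin m → Fin (m + m) → Bool, ∀ i, T i = Fin.append zeroVec (Pi.single i true) :=
    ⟨_, fun _ => rfl⟩
  obtain ⟨D1, hD1⟩ : ∃ D1 : Fin m → (Fin (m + m) → Bool) → Bool, ∀ i z, D1 i z = (f z ^^ f (bxor z (T i))) :=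
    ⟨fun i z => f z ^^ f (bxor z (T i)), fun _ _ => rfl⟩
  obtain ⟨D2, hD2⟩ : ∃ D2 : Fin m → Fin m → (Fin (m + m) → Bool) → Bool,
      ∀ i j z, D2 i j z = (D1 i z ^^ D1 i (bxor z (T j))) := ⟨fun i j z => D1 i z ^^ D1 i (bxor z (T j)), fun _ _ _ => rfl⟩
  obtain ⟨q, hq⟩ : ∃ q : (Fin m → Bool) → (Fin m → Bool) → Bool,
      ∀ y x, q y x = (f (Fin.append (π y) x) ^^ l y x) := ⟨_, fun _ _ => rfl⟩
  have hD1deg : ∀ i, IsDegLeFun 2 (D1 i) := fun i => by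
    rw [show D1 i = fun z => (f z ^^ f (bxor z (T i))) from funext (hD1 i)]; exact hD (m + m) 2 f (T i) hf
  have hD2deg : ∀ i j, IsDegLeFun 1 (D2 i j) := fun i j => by
    rw [show D2 i j = fun z => (D1 i z ^^ D1 i (bxor z (T j))) from funext (hD2 i j)]
    exact hD (m + m) 1 (D1 i) (T j) (hD1deg i)
  have hqdeg : ∀ y, IsDegLeFun 3 (q y) := fun y => by
    rw [show q y = fun x => (f (Fin.append (π y) x) ^^ l y x) from funext (hq y)]
    exact mf_deg_bxor (mf_isDegLeFun_comp hf (fun x => Fin.append (π y) x) (mf_deg_coord_append_left (π y))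
      (by norm_num)) ((hl1 y).mono (by norm_num))
  have hshift : ∀ (c x : Fin m → Bool) (i : Fin m),
      bxor (Fin.append c x) (T i) = Fin.append c (bxor x (Pi.single i true)) := fun c x i => by
    rw [hT, mf_bxor_append, bxor_zeroVec]
  -- first and second coordinate derivatives of the fibre functions
  have hR1 : ∀ y i x, (q y x ^^ q y (bxor x (Pi.single i true))) = (D1 i (Fin.append (π y) x) ^^ y i) := by
    intro y i x
    rw [hq, hq, hD1, hshift, (mf_lin_props (hl y)).1, (mf_lin_props (hl y)).2.1]
    exact mf_id1 _ _ _ _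
  have hR2 : ∀ y i j x, ((D1 i (Fin.append (π y) x) ^^ y i) ^^ (D1 i (Fin.append (π y) (bxor x (Pi.single j true))) ^^ y i))
      = D2 i j (Fin.append (π y) x) := fun y i j x => by
    rw [hD2, hshift]
    exact mf_id2 _ _ _
  -- the three kinds of fibres
  have fibA : ∀ y i j x₀, D2 i j (Fin.append (π y) x₀) = true → |∑ x, signOf (q y x)| ≤ 3 / 4 * (2 : ℝ) ^ m := by
    intro y i j x₀ hx₀
    have e : ((q y x₀ ^^ q y (bxor x₀ (Pi.single i true))) ^^ (q y (bxor x₀ (Pi.single j true)) ^^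
        q y (bxor (bxor x₀ (Pi.single j true)) (Pi.single i true)))) = true := by rw [hR1, hR1, hR2, hx₀]
    obtain ⟨h1, h0⟩ := mf_odd4 _ _ _ _ e
    exact mf_bias hR (hqdeg y) (by rcases h1 with h | h | h | h <;> exact ⟨_, h⟩)
      (by rcases h0 with h | h | h | h <;> exact ⟨_, h⟩)
  have fibC : ∀ y, (∀ i j x, D2 i j (Fin.append (π y) x) = false) →
      ∀ i x₀, (D1 i (Fin.append (π y) x₀) ^^ y i) = true → ∑ x, signOf (q y x) = 0 := by
    intro y hA i x₀ hx₀
    have hc : ∀ x, (D1 i (Fin.append (π y) x) ^^ y i) = (D1 i (Fin.append (π y) zeroVec) ^^ y i) :=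
      mf_const_of_shift (fun x => D1 i (Fin.append (π y) x) ^^ y i) fun j x =>
        mf_xor_false _ _ ((hR2 y i j x).trans (hA i j x))
    exact mf_sum_signOf_eq_zero_of_flip (q y) (Pi.single i true) fun x =>
      mf_xor_true _ _ ((hR1 y i x).trans ((hc x).trans ((hc x₀).symm.trans hx₀)))
  have fibK : ∀ y, (∀ i x, (D1 i (Fin.append (π y) x) ^^ y i) = false) →
      ∑ x, signOf (q y x) = (2 : ℝ) ^ m * signOf (f (Fin.append (π y) zeroVec)) := by
    intro y hC
    have hc := mf_const_of_shift (q y) (fun i x => mf_xor_false _ _ ((hR1 y i x).trans (hC i x)))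
    rw [show ∑ x, signOf (q y x) = ∑ _x : Fin m → Bool, signOf (q y zeroVec) from sum_congr rfl fun x _ => by rw [hc x],
      sum_const, card_univ, Fintype.card_fun, Fintype.card_bool, Fintype.card_fin, nsmul_eq_mul, hq,
      (mf_lin_props (hl y)).2.2, Bool.xor_false]
    push_cast
    rfl
  -- Φ through F1, and the common endgame
  have hΦ := hW m f g π h hg
  simp_rw [show ∀ y, ∑ x, signOf (f (Fin.append (π y) x)) * twist x y = ∑ x, signOf (q y x) from
    fun y => sum_congr rfl fun x _ => by rw [hq, signOf_xor, hl]] at hΦ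
  rw [hΦ]
  have h2m : (2 : ℝ) ^ (2 * m) = 2 ^ m * 2 ^ m := by rw [two_mul, pow_add]
  have hMpos : (0 : ℝ) < 2 ^ m * 2 ^ m := by positivity
  have fin : ∑ y, |∑ x, signOf (q y x)| ≤ 15 / 16 * ((2 : ℝ) ^ m * 2 ^ m) →
      ((2 : ℝ) ^ (2 * m))⁻¹ * ∑ y, signOf (h y) * ∑ x, signOf (q y x) ≤ 31 / 32 := fun hb => by
    have h1 : ∑ y, signOf (h y) * ∑ x, signOf (q y x) ≤ ∑ y, |∑ x, signOf (q y x)| :=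
      sum_le_sum fun y _ => (le_abs_self _).trans (by rw [abs_mul, abs_signOf, one_mul])
    rw [h2m, inv_mul_le_iff₀ hMpos]
    linarith
  by_cases hA : ∃ y i j x, D2 i j (Fin.append (π y) x) = true
  · -- a non-affine fibre: ≥ 1/4 of the fibres are non-affine
    obtain ⟨y₀, i, j, x₀, h₀⟩ := hA
    have hv : IsDegLeFun 2 (fun y => D2 i j (Fin.append (π y) x₀)) :=
      mf_isDegLeFun_comp (hD2deg i j) (fun y => Fin.append (π y) x₀) (mf_deg_coord_append_pi hπ x₀) (by norm_num)
    have hRv := (Nat.cast_le (α := ℝ)).2 (hR m 2 _ hv ⟨y₀, h₀⟩)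
    push_cast at hRv
    exact Or.inr (fin (mf_avg_core (fun y => ∑ x, signOf (q y x)) (fun y => mf_abs_sum_signOf_le (q y))
      (univ.filter fun y => D2 i j (Fin.append (π y) x₀) = true) (3 / 4 * 2 ^ m)
      (fun y hy => fibA y i j x₀ (mem_filter.1 hy).2) (by nlinarith [hRv, pow_pos (show (0 : ℝ) < 2 by norm_num) m])))
  by_cases hC : ∃ y i x, (D1 i (Fin.append (π y) x) ^^ y i) = true
  · -- all fibres affine, one non-constant: ≥ 1/16 of the fibres are balanced
    simp only [not_exists, Bool.not_eq_true] at hA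
    obtain ⟨y₀, i, x₀, h₀⟩ := hC
    have hv : IsDegLeFun 4 (fun y => D1 i (Fin.append (π y) x₀) ^^ y i) :=
      mf_deg_bxor (mf_isDegLeFun_comp (hD1deg i) (fun y => Fin.append (π y) x₀) (mf_deg_coord_append_pi hπ x₀)
        (by norm_num)) (isDegLeFun_apply i (by norm_num))
    have hRv := (Nat.cast_le (α := ℝ)).2 (hR m 4 _ hv ⟨y₀, h₀⟩)
    push_cast at hRv
    exact Or.inr (fin (mf_avg_core (fun y => ∑ x, signOf (q y x)) (fun y => mf_abs_sum_signOf_le (q y))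
      (univ.filter fun y => (D1 i (Fin.append (π y) x₀) ^^ y i) = true) 0
      (fun y hy => (abs_eq_zero.2 (fibC y (hA y) i x₀ (mem_filter.1 hy).2)).le)
      (by nlinarith [hRv, pow_pos (show (0 : ℝ) < 2 by norm_num) m])))
  -- every fibre is constant: Φ is the bias of a word of degree ≤ 6
  simp only [not_exists, Bool.not_eq_true] at hC
  have hsum : ∑ y, signOf (h y) * ∑ x, signOf (q y x) = 2 ^ m * ∑ y, signOf (h y ^^ f (Fin.append (π y) zeroVec)) := by
    rw [mul_sum]
    exact sum_congr rfl fun y _ => by rw [fibK y (hC y), signOf_xor]; ring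
  rw [hsum, h2m]
  have hc6 : IsDegLeFun 6 (fun y => h y ^^ f (Fin.append (π y) zeroVec)) :=
    mf_deg_bxor (hh.mono (by norm_num)) (mf_isDegLeFun_comp hf (fun y => Fin.append (π y) zeroVec)
      (mf_deg_coord_append_pi hπ zeroVec) (by norm_num))
  by_cases hz : ∃ y, (h y ^^ f (Fin.append (π y) zeroVec)) = true
  · right
    have h1 := (Nat.cast_le (α := ℝ)).2 (hR m 6 _ hc6 hz)
    push_cast at h1
    rw [mf_sum_signOf_eq_card (fun y => h y ^^ f (Fin.append (π y) zeroVec)), inv_mul_le_iff₀ hMpos]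
    nlinarith [h1, pow_pos (show (0 : ℝ) < 2 by norm_num) m]
  · left
    simp only [not_exists, Bool.not_eq_true] at hz
    rw [show ∑ y, signOf (h y ^^ f (Fin.append (π y) zeroVec)) = ∑ _y : Fin m → Bool, (1 : ℝ) from
      sum_congr rfl fun y _ => by rw [hz y]; rfl, sum_const, card_univ, Fintype.card_fun, Fintype.card_bool,
      Fintype.card_fin, nsmul_eq_mul, mul_one]
    push_cast
    exact inv_mul_cancel₀ hMpos.ne'

end Summit.QuantumAdvantage.QuantumAdvantage.Theorems.CubicForrelation.NearExactIsExact

end
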